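import Summits.ValiantsHypothesis.ValiantsHypothesis.Theorems.LacunarySymmetroidMatrixDescartesCensusDoorA34NodeChambers
import Summits.ValiantsHypothesis.ValiantsHypothesis.Theorems.LacunarySymmetroidMatrixDescartesCensusDoorA34RootRank

/-!
# `MatrixDescartes` census — DOOR A at `(3,4)`: the node TYPE LAW at arbitrary node positions, and its bridge to the conic type
# `tr adj` of a nineteen

HONEST FRAMING.  Object-search cell `pub-symmetroid`, door-A seat `val-sym-door-p3` (g9); item stmt-ValiantsHypothesis-19980
`DoorA34 = PosRootLawAt 3 4 18` (route item `Theses.LacunarySymmetroid.DoorA34`) is OPEN and asserted nowhere in this file.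
Packaging of `…CensusDoorA34NodeChambers` (class R4 chamber law, stated there with the negative node LAST / the positive nodes
FIRST) for arbitrary node positions, and the bridge to `…CensusDoorA34RootRank` (conic TYPE `tr adj P(r)` at a root of a
nineteen, the quantity whose sign changes `…RootType.sgnChanges_type_le_nine_of_nineteen` bounds by `9`):

* `posSemidef_of_oneNeg` / `neg_posSemidef_of_onePos` — `M = ∑ᵢ ℓᵢ • vᵢvᵢᵀ` with a frame in GENERAL POSITION (every three of the
  `vᵢ` independent), all `ℓᵢ > 0` except possibly at ONE position `j` (resp. all `< 0` except at `j`), and `det M = 0` ⇒ `M ⪰ 0`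
  (resp. `−M ⪰ 0`);
* `not_posSemidef_of_twoPos_twoNeg'` — two positive and two negative node values at ANY positions (frame spanning) ⇒ neither `M`
  nor `−M` is `⪰ 0`;
* **`trace_adjugate_pos_of_oneNeg_of_nineteen`**, **`trace_adjugate_neg_of_twoNeg_of_nineteen`** — for a real symmetric `(3,4)`
  pencil with NINETEEN distinct positive det-roots whose letters lie in a general-position four-real-node net
  (`S l = ∑ᵢ A i l • vᵢvᵢᵀ`), at a root `r`: if exactly one node nomial is negative (or exactly one positive) then `tr adj P(r) > 0`
  (semidefinite conic type), and if two are negative and two positive then `tr adj P(r) < 0` (real line pair).  So along an R4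
  nineteen the type word of `…RootType` IS the parity word of the node sign vectors, and its `≤ 9` sign changes are changes
  between `3–1` and `2–2` chambers.

Nothing here bounds `ζ_sym(3,4)`; `DoorA34` stays OPEN; nothing bears on `MatrixDescartes` (stmt-ValiantsHypothesis-18050) or on
`VP ≠ VNP`.  [folklore] Bookkeeping over the two cited files.
-/

-- `Summit.ValiantsHypothesis.ValiantsHypothesis.…` repeats a component by the D-0017 layout
-- (single-conjunct summit), which the `dupNamespace` linter flags; the name is mandated.
set_option linter.dupNamespace false

namespace Summit.ValiantsHypothesis.ValiantsHypothesis.Theorems.LacunarySymmetroidMatrixDescartes.Census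

open Finset Polynomial
open scoped BigOperators Matrix
open Summit.ValiantsHypothesis.ValiantsHypothesis.Theorems.SymmetroidDescartes (eval_det_pencil)

/-! ## Reindexing the four-node sum -/

/-- Reindexing the node sum by a permutation of the labels. [folklore] -/
theorem sum_four_rankOne_reindex (v : Fin 4 → Fin 3 → ℝ) (ℓ : Fin 4 → ℝ) (σ : Equiv.Perm (Fin 4)) :
    (∑ i, ℓ (σ i) • Matrix.vecMulVec (v (σ i)) (v (σ i))) = ∑ i, ℓ i • Matrix.vecMulVec (v i) (v i) :=
  Equiv.sum_comp σ (fun i => ℓ i • Matrix.vecMulVec (v i) (v i))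

/-- Reindexing the frame Gram sum by a permutation of the labels. [folklore] -/
theorem sum_four_vecMulVec_reindex (v : Fin 4 → Fin 3 → ℝ) (σ : Equiv.Perm (Fin 4)) :
    (∑ i, Matrix.vecMulVec (v (σ i)) (v (σ i))) = ∑ i, Matrix.vecMulVec (v i) (v i) :=
  Equiv.sum_comp σ (fun i => Matrix.vecMulVec (v i) (v i))

/-! ## One exceptional node: semidefinite -/

/-- **One negative node value at ANY position ⇒ `M ⪰ 0` at a det-root** (frame in general position: every three of the four
`vᵢ` independent, stated as the non-vanishing of all ordered `3 × 3` row determinants). [folklore] -/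
theorem posSemidef_of_oneNeg (v : Fin 4 → Fin 3 → ℝ) (ℓ : Fin 4 → ℝ)
    (hgp : ∀ a b c : Fin 4, a ≠ b → b ≠ c → a ≠ c → (Matrix.of ![v a, v b, v c]).det ≠ 0)
    (j : Fin 4) (hpos : ∀ i, i ≠ j → 0 < ℓ i) (hdet : (∑ i, ℓ i • Matrix.vecMulVec (v i) (v i)).det = 0) :
    (∑ i, ℓ i • Matrix.vecMulVec (v i) (v i)).PosSemidef := by
  -- move the exceptional node to position 3 with the transposition (j 3)
  set σ : Equiv.Perm (Fin 4) := Equiv.swap j 3 with hσ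
  have hσ3 : σ 3 = j := by rw [hσ, Equiv.swap_apply_right]
  have hne : ∀ i : Fin 4, i ≠ 3 → σ i ≠ j := by
    intro i hi h
    have : σ (σ i) = σ j := by rw [h]
    rw [hσ, Equiv.swap_apply_self, Equiv.swap_apply_left] at this
    exact hi this
  have key := posSemidef_of_threePos (fun i => v (σ i)) (fun i => ℓ (σ i)) (hpos _ (hne 0 (by decide)))
    (hpos _ (hne 1 (by decide))) (hpos _ (hne 2 (by decide))) ?_ ?_
  · rwa [sum_four_rankOne_reindex v ℓ σ] at key
  · refine hgp (σ 0) (σ 1) (σ 2) ?_ ?_ ?_ <;> intro h <;> have := σ.injective h <;> simp at this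
  · rw [sum_four_rankOne_reindex v ℓ σ]; exact hdet

/-- **One positive node value at ANY position ⇒ `−M ⪰ 0` at a det-root.** [folklore] -/
theorem neg_posSemidef_of_onePos (v : Fin 4 → Fin 3 → ℝ) (ℓ : Fin 4 → ℝ)
    (hgp : ∀ a b c : Fin 4, a ≠ b → b ≠ c → a ≠ c → (Matrix.of ![v a, v b, v c]).det ≠ 0)
    (j : Fin 4) (hneg : ∀ i, i ≠ j → ℓ i < 0) (hdet : (∑ i, ℓ i • Matrix.vecMulVec (v i) (v i)).det = 0) :
    (-(∑ i, ℓ i • Matrix.vecMulVec (v i) (v i))).PosSemidef := by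
  rw [← sum_four_rankOne_neg]
  refine posSemidef_of_oneNeg v (fun i => -ℓ i) hgp j (fun i hi => neg_pos.mpr (hneg i hi)) ?_
  rw [sum_four_rankOne_neg, Matrix.det_neg, hdet, mul_zero]

/-! ## Two and two: indefinite -/

/-- **Two positive and two negative node values at ANY positions (frame spanning `ℝ³`) ⇒ neither `M` nor `−M` is `⪰ 0`.** [folklore] -/
theorem not_posSemidef_of_twoPos_twoNeg' (v : Fin 4 → Fin 3 → ℝ) (ℓ : Fin 4 → ℝ)
    (hv : (∑ i, Matrix.vecMulVec (v i) (v i)).det ≠ 0) (a b : Fin 4) (hab : a ≠ b) (ha : 0 < ℓ a) (hb : 0 < ℓ b)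
    (hneg : ∀ i, i ≠ a → i ≠ b → ℓ i < 0) :
    ¬ (∑ i, ℓ i • Matrix.vecMulVec (v i) (v i)).PosSemidef ∧ ¬ (-(∑ i, ℓ i • Matrix.vecMulVec (v i) (v i))).PosSemidef := by
  -- a permutation σ with σ 0 = a, σ 1 = b
  set τ : Equiv.Perm (Fin 4) := Equiv.swap 0 a with hτ
  set b' : Fin 4 := τ.symm b with hb'
  have hb'0 : b' ≠ 0 := by
    intro h
    have : τ b' = τ 0 := by rw [h]
    rw [hb', Equiv.apply_symm_apply, hτ, Equiv.swap_apply_left] at this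
    exact hab this.symm
  set σ : Equiv.Perm (Fin 4) := τ * Equiv.swap 1 b' with hσ
  have hσ0 : σ 0 = a := by
    rw [hσ, Equiv.Perm.mul_apply, Equiv.swap_apply_of_ne_of_ne (by decide) hb'0.symm, hτ, Equiv.swap_apply_left]
  have hσ1 : σ 1 = b := by
    rw [hσ, Equiv.Perm.mul_apply, Equiv.swap_apply_left, hb', Equiv.apply_symm_apply]
  have h2 : ℓ (σ 2) < 0 := hneg _ (by rw [← hσ0]; exact fun h => absurd (σ.injective h) (by decide))
    (by rw [← hσ1]; exact fun h => absurd (σ.injective h) (by decide))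
  have h3 : ℓ (σ 3) < 0 := hneg _ (by rw [← hσ0]; exact fun h => absurd (σ.injective h) (by decide))
    (by rw [← hσ1]; exact fun h => absurd (σ.injective h) (by decide))
  have key := not_posSemidef_of_twoPos_twoNeg (fun i => v (σ i)) (fun i => ℓ (σ i)) (by rw [hσ0]; exact ha)
    (by rw [hσ1]; exact hb) h2 h3 (by rw [sum_four_vecMulVec_reindex v σ]; exact hv)
  rwa [sum_four_rankOne_reindex v ℓ σ] at key

/-! ## Bridge to the conic type of a nineteen -/

/-- At a det-root of a real symmetric `3 × 3` pencil, a positive semidefinite value has `tr adj ≥ 0`, and for a NINETEEN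
(`tr adj ≠ 0` at every root, `…RootRank`) therefore `tr adj > 0`. [folklore] -/
theorem trace_adjugate_pos_of_posSemidef_of_nineteen (d : Fin 4 → ℕ) (S : Fin 4 → Matrix (Fin 3) (Fin 3) ℝ)
    (hS : ∀ l, (S l).IsSymm)
    (h19 : 19 ≤ ((Matrix.det (∑ l, ((X : ℝ[X]) ^ d l) • (S l).map C)).roots.toFinset.filter (fun t => 0 < t)).card)
    {r : ℝ} (hr0 : 0 < r) (hr : (Matrix.det (∑ l, ((X : ℝ[X]) ^ d l) • (S l).map C)).IsRoot r)
    (hpsd : (∑ l, r ^ d l • S l).PosSemidef) : 0 < (∑ l, r ^ d l • S l).adjugate.trace := by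
  have hne := trace_adjugate_pencil_ne_zero_of_nineteen d S hS h19 hr0 hr
  have hq : ∀ v, 0 ≤ v ⬝ᵥ ((∑ l, r ^ d l • S l) *ᵥ v) := fun v => by
    have h := hpsd.dotProduct_mulVec_nonneg v
    rwa [star_trivial] at h
  exact lt_of_le_of_ne (trace_adjugate_nonneg_of_quadForm_nonneg (isSymm_pencil_eval d hS r) hq) hne.symm

/-- … and a value at which NEITHER `P(r)` nor `−P(r)` is positive semidefinite has `tr adj P(r) < 0` (for a nineteen). [folklore] -/
theorem trace_adjugate_neg_of_not_posSemidef_of_nineteen (d : Fin 4 → ℕ) (S : Fin 4 → Matrix (Fin 3) (Fin 3) ℝ)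
    (hS : ∀ l, (S l).IsSymm)
    (h19 : 19 ≤ ((Matrix.det (∑ l, ((X : ℝ[X]) ^ d l) • (S l).map C)).roots.toFinset.filter (fun t => 0 < t)).card)
    {r : ℝ} (hr0 : 0 < r) (hr : (Matrix.det (∑ l, ((X : ℝ[X]) ^ d l) • (S l).map C)).IsRoot r)
    (hnot : ¬ (∑ l, r ^ d l • S l).PosSemidef ∧ ¬ (-(∑ l, r ^ d l • S l)).PosSemidef) :
    (∑ l, r ^ d l • S l).adjugate.trace < 0 := by
  have hA : (∑ l, r ^ d l • S l).IsSymm := isSymm_pencil_eval d hS r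
  have hAh : (∑ l, r ^ d l • S l).IsHermitian := by
    simpa [Matrix.isHermitian_iff_isSymm] using hA
  rcases root_type_dichotomy_of_nineteen d S hS h19 hr0 hr with ⟨hpos, hsemi⟩ | ⟨hneg, _⟩
  · -- semidefinite with the sign of the trace: contradiction with `hnot`
    exfalso
    rcases le_or_gt 0 (∑ l, r ^ d l • S l).trace with htr | htr
    · rcases lt_or_eq_of_le htr with htr | htr
      · refine hnot.1 (Matrix.PosSemidef.of_dotProduct_mulVec_nonneg hAh fun v => ?_)
        rw [star_trivial]
        have h := hsemi v
        have hsq : 0 ≤ ((∑ l, r ^ d l • S l) *ᵥ v) ⬝ᵥ ((∑ l, r ^ d l • S l) *ᵥ v) := by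
          simp only [dotProduct]; exact Finset.sum_nonneg fun i _ => mul_self_nonneg _
        nlinarith
      · -- trace zero: then `P(r) v = 0` for all `v`, so `P(r) ⪰ 0` trivially — contradiction again
        refine hnot.1 (Matrix.PosSemidef.of_dotProduct_mulVec_nonneg hAh fun v => ?_)
        rw [star_trivial]
        have h := hsemi v
        rw [← htr, zero_mul] at h
        have hsq : 0 ≤ ((∑ l, r ^ d l • S l) *ᵥ v) ⬝ᵥ ((∑ l, r ^ d l • S l) *ᵥ v) := by
          simp only [dotProduct]; exact Finset.sum_nonneg fun i _ => mul_self_nonneg _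
        have hz : ((∑ l, r ^ d l • S l) *ᵥ v) ⬝ᵥ ((∑ l, r ^ d l • S l) *ᵥ v) = 0 := le_antisymm h hsq
        have hMv : (∑ l, r ^ d l • S l) *ᵥ v = 0 := by
          have : ∀ i, ((∑ l, r ^ d l • S l) *ᵥ v) i * ((∑ l, r ^ d l • S l) *ᵥ v) i = 0 := by
            have hsum := (Finset.sum_eq_zero_iff_of_nonneg fun i _ => mul_self_nonneg (((∑ l, r ^ d l • S l) *ᵥ v) i)).mp
              (by simpa [dotProduct] using hz)
            exact fun i => hsum i (Finset.mem_univ i)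
          funext i
          exact mul_self_eq_zero.mp (this i)
        rw [hMv, dotProduct_zero]
    · refine hnot.2 (Matrix.PosSemidef.of_dotProduct_mulVec_nonneg hAh.neg fun v => ?_)
      rw [star_trivial, Matrix.neg_mulVec, dotProduct_neg]
      have h := hsemi v
      have hsq : 0 ≤ ((∑ l, r ^ d l • S l) *ᵥ v) ⬝ᵥ ((∑ l, r ^ d l • S l) *ᵥ v) := by
        simp only [dotProduct]; exact Finset.sum_nonneg fun i _ => mul_self_nonneg _
      nlinarith
  · exact hneg

/-- **R4 NINETEEN: `3–1` chamber ⇒ semidefinite conic type `tr adj > 0`.**  For a real symmetric `(3,4)` pencil with nineteen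
distinct positive det-roots whose letters lie in a general-position four-real-node net, `S l = ∑ᵢ A i l • vᵢvᵢᵀ`, at a root `r`
where all node nomials but the `j`-th are positive, `tr adj P(r) > 0`. [folklore] -/
theorem trace_adjugate_pos_of_oneNeg_of_nineteen (d : Fin 4 → ℕ) (A : Fin 4 → Fin 4 → ℝ) (v : Fin 4 → Fin 3 → ℝ)
    (hgp : ∀ a b c : Fin 4, a ≠ b → b ≠ c → a ≠ c → (Matrix.of ![v a, v b, v c]).det ≠ 0)
    (h19 : 19 ≤ ((Matrix.det (∑ l, ((X : ℝ[X]) ^ d l) •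
      (∑ i, A i l • Matrix.vecMulVec (v i) (v i)).map C)).roots.toFinset.filter (fun t => 0 < t)).card)
    {r : ℝ} (hr0 : 0 < r)
    (hr : (Matrix.det (∑ l, ((X : ℝ[X]) ^ d l) • (∑ i, A i l • Matrix.vecMulVec (v i) (v i)).map C)).IsRoot r)
    (j : Fin 4) (hpos : ∀ i, i ≠ j → 0 < ∑ l, A i l * r ^ d l) :
    0 < (∑ l, r ^ d l • ∑ i, A i l • Matrix.vecMulVec (v i) (v i)).adjugate.trace := by
  have hS : ∀ l, (∑ i, A i l • Matrix.vecMulVec (v i) (v i)).IsSymm := fun l => by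
    have h := isHermitian_sum_four_rankOne v (fun i => A i l)
    simpa [Matrix.isHermitian_iff_isSymm] using h
  refine trace_adjugate_pos_of_posSemidef_of_nineteen d _ hS h19 hr0 hr ?_
  have hdet : (∑ i, (∑ l, A i l * r ^ d l) • Matrix.vecMulVec (v i) (v i)).det = 0 := by
    rw [← pencil_eval_eq_sum_nodeNomial_smul, ← eval_det_pencil]; exact hr
  rw [pencil_eval_eq_sum_nodeNomial_smul]
  exact posSemidef_of_oneNeg v _ hgp j hpos hdet

/-- **R4 NINETEEN: `1–3` chamber ⇒ `tr adj > 0` as well** (negative semidefinite value). [folklore] -/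
theorem trace_adjugate_pos_of_onePos_of_nineteen (d : Fin 4 → ℕ) (A : Fin 4 → Fin 4 → ℝ) (v : Fin 4 → Fin 3 → ℝ)
    (hgp : ∀ a b c : Fin 4, a ≠ b → b ≠ c → a ≠ c → (Matrix.of ![v a, v b, v c]).det ≠ 0)
    (h19 : 19 ≤ ((Matrix.det (∑ l, ((X : ℝ[X]) ^ d l) •
      (∑ i, A i l • Matrix.vecMulVec (v i) (v i)).map C)).roots.toFinset.filter (fun t => 0 < t)).card)
    {r : ℝ} (hr0 : 0 < r)
    (hr : (Matrix.det (∑ l, ((X : ℝ[X]) ^ d l) • (∑ i, A i l • Matrix.vecMulVec (v i) (v i)).map C)).IsRoot r)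
    (j : Fin 4) (hneg : ∀ i, i ≠ j → ∑ l, A i l * r ^ d l < 0) :
    0 < (∑ l, r ^ d l • ∑ i, A i l • Matrix.vecMulVec (v i) (v i)).adjugate.trace := by
  have hS : ∀ l, (∑ i, A i l • Matrix.vecMulVec (v i) (v i)).IsSymm := fun l => by
    have h := isHermitian_sum_four_rankOne v (fun i => A i l)
    simpa [Matrix.isHermitian_iff_isSymm] using h
  have hne := trace_adjugate_pencil_ne_zero_of_nineteen d _ hS h19 hr0 hr
  have hdet : (∑ i, (∑ l, A i l * r ^ d l) • Matrix.vecMulVec (v i) (v i)).det = 0 := by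
    rw [← pencil_eval_eq_sum_nodeNomial_smul, ← eval_det_pencil]; exact hr
  have hnsd : (-(∑ l, r ^ d l • ∑ i, A i l • Matrix.vecMulVec (v i) (v i))).PosSemidef := by
    rw [pencil_eval_eq_sum_nodeNomial_smul]
    exact neg_posSemidef_of_onePos v _ hgp j hneg hdet
  have hq : ∀ w, 0 ≤ w ⬝ᵥ ((-(∑ l, r ^ d l • ∑ i, A i l • Matrix.vecMulVec (v i) (v i))) *ᵥ w) := fun w => by
    have h := hnsd.dotProduct_mulVec_nonneg w
    rwa [star_trivial] at h
  have h0 := trace_adjugate_nonneg_of_quadForm_nonneg (isSymm_pencil_eval d hS r).neg hq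
  rw [adjugate_neg_fin_three] at h0
  exact lt_of_le_of_ne h0 hne.symm

/-- **R4 NINETEEN: `2–2` chamber ⇒ indefinite conic type `tr adj < 0`** (a real line pair; a middle-eigenvalue crossing).  Frame
spanning `ℝ³` suffices here. [folklore] -/
theorem trace_adjugate_neg_of_twoNeg_of_nineteen (d : Fin 4 → ℕ) (A : Fin 4 → Fin 4 → ℝ) (v : Fin 4 → Fin 3 → ℝ)
    (hv : (∑ i, Matrix.vecMulVec (v i) (v i)).det ≠ 0)
    (h19 : 19 ≤ ((Matrix.det (∑ l, ((X : ℝ[X]) ^ d l) •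
      (∑ i, A i l • Matrix.vecMulVec (v i) (v i)).map C)).roots.toFinset.filter (fun t => 0 < t)).card)
    {r : ℝ} (hr0 : 0 < r)
    (hr : (Matrix.det (∑ l, ((X : ℝ[X]) ^ d l) • (∑ i, A i l • Matrix.vecMulVec (v i) (v i)).map C)).IsRoot r)
    (a b : Fin 4) (hab : a ≠ b) (ha : 0 < ∑ l, A a l * r ^ d l) (hb : 0 < ∑ l, A b l * r ^ d l)
    (hneg : ∀ i, i ≠ a → i ≠ b → ∑ l, A i l * r ^ d l < 0) :
    (∑ l, r ^ d l • ∑ i, A i l • Matrix.vecMulVec (v i) (v i)).adjugate.trace < 0 := by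
  have hS : ∀ l, (∑ i, A i l • Matrix.vecMulVec (v i) (v i)).IsSymm := fun l => by
    have h := isHermitian_sum_four_rankOne v (fun i => A i l)
    simpa [Matrix.isHermitian_iff_isSymm] using h
  refine trace_adjugate_neg_of_not_posSemidef_of_nineteen d _ hS h19 hr0 hr ?_
  rw [pencil_eval_eq_sum_nodeNomial_smul]
  exact not_posSemidef_of_twoPos_twoNeg' v _ hv a b hab ha hb hneg

end Summit.ValiantsHypothesis.ValiantsHypothesis.Theorems.LacunarySymmetroidMatrixDescartes.Census
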